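/-
Origin: expansion seat `planner-pub-hodgecm-pv10-g4-0`, handover #12 2026-08-18T13:23:02Z ; rewrite: ^import Pv10g4\.QuotientInStages -> import HodgeCM.PerL34.QuotientInStages (`HOME/pub-hodgecm-pv10-g4/lean/Pv10g4/StagesCovering.lean`, md5 656ac451, 287 lines);
landed by the gen-8 packager in gate run 30 as `HodgeCM/PerL34/StagesCovering.lean` (import ^import Pv10g4\.QuotientInStages[ \t]*$→import HodgeCM.PerL34.QuotientInStages ×1; stripped 6 #print/#check/#eval lines).
-/
/-
Origin: HOME/pub-hodgecm-pv10-g4/lean/Pv10g4/StagesCovering.lean (WIP module `Pv10g4.StagesCovering`;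
intended final place `HodgeCM/PerL34/StagesCovering.lean` = module `HodgeCM.PerL34.StagesCovering`)
(import rewrite on landing: `import Pv10g4.QuotientInStages` ↦ `import HodgeCM.PerL34.QuotientInStages`; the other
two imports are Mathlib / a tree module and stay).
-/
import Mathlib.Topology.Covering.Quotient
import Summits.HodgeConjecture.HodgeCM.PerL34.ProperQuotient
import Summits.HodgeConjecture.HodgeCM.PerL34.QuotientInStages_2

/-!
# `X/Γ₁ → X/Γ` is a finite covering map (PerL v5 l. 75 "finite étale", analytic form; KERNEL)

PerL v5 §1.2, ll. 74–75: "for torsion-free `Γ`, … there is a neat normal `K_1 ⊂ K_f` of finite index with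
`P^L_{Γ_1} → P^L_Γ` finite étale".  Row #11 (`QuotientInStages`) gave, for ANY action and `Γ₁ ⊴ Γ` of finite
index, the deck group `D ≤ Perm (X/Γ₁)` (finite), `(X/Γ₁)/D ≃ₜ X/Γ`, and — when `Γ` acts freely — that `D`
acts freely on `X/Γ₁` with `|D| = [Γ : Γ₁]`.  This file adds the TOPOLOGICAL covering statement:

* §1 (general): a FINITE group acting freely by homeomorphisms on a HAUSDORFF space has, at every point, a
  neighbourhood disjoint from all its non-trivial translates (`exists_nhds_image_smul_disjoint_of_finite`);
* §2 (stages): if `G` acts on `X` by homeomorphisms, `Γ₁ ⊴ Γ ≤ G` has finite index, `Γ` acts FREELY on `X`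
  and `X/Γ₁` is Hausdorff, then the orbit map `X/Γ₁ → X/Γ` is a QUOTIENT COVERING MAP for the deck group
  (Mathlib's `IsQuotientCoveringMap`: `isQuotientCoveringMap_orbitMap`), hence a **covering map**
  (`isCoveringMap_orbitMap`) whose fibres are `D`-torsors of cardinality `[Γ : Γ₁]`
  (`fiberOrbitMapEquiv`, `natCard_fiber_orbitMap`) — "finite étale of degree `[Γ : Γ₁]`";
* §3 (PerL): for `U(H)`, `C ≤ U(H)(ℝ)` compact, `Γ_H(gK₁g⁻¹) ⊴ Γ_H(gK_fg⁻¹)` of finite index (`gK₁g⁻¹`,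
  `gK_fg⁻¹` compact, so both lattices are discrete, row #4) and `Γ_H(gK_fg⁻¹)` TORSION-FREE: the map of pieces
  `Γ_H(gK₁g⁻¹)\Y → Γ_H(gK_fg⁻¹)\Y`, `Y = U(H)(ℝ)/C`, is a covering map with fibres of cardinality
  `[Γ_H(gK_fg⁻¹) : Γ_H(gK₁g⁻¹)]` (`isCoveringMap_pieceOrbitMap`, `natCard_fiber_pieceOrbitMap`; Hausdorffness
  of `Γ₁\Y` is the tree's `ArchCompactK.t2Space_orbitQuotient_of_discrete`, freeness is row #5's
  `stabilizer_inf_eq_bot_of_torsionFree`); and for `G_U` with `K_f ≤ K_H(3)` compact open (so that EVERY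
  `Γ_H(gK_fg⁻¹)` is torsion-free, row #8) the level `K₁` of row #9 yields covering maps for every `g` —
  **`HodgeCM.HermSpace3.exists_pieces_isCoveringMap`**.

Kernel theorems over rows #5/#8/#9/#11, the tree's `HodgeCM.PerL34.ProperQuotient` and Mathlib's
`Topology.Covering.Quotient` only; nothing cited, nothing posited; `#print axioms` = the standard trio.
NOT claimed: complex-analytic or algebraic "étale", anything about `P_K` as a variety.
-/

noncomputable section

open scoped Pointwise
open MulAction Topology

namespace HodgeCM.PerL34.Godement

namespace Stages

/-! ## §1  Finite free actions on Hausdorff spaces -/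

section FiniteFree

variable {D E : Type*} [Group D] [MulAction D E] [TopologicalSpace E] [ContinuousConstSMul D E]
  [T2Space E] [Finite D]

/-- A finite group acting freely by homeomorphisms on a Hausdorff space: every point has a neighbourhood
`U` with `dU ∩ U = ∅` for all `d ≠ 1` (the finite case of Mathlib's
`ProperlyDiscontinuousSMul.exists_nhds_image_smul_eq_self`, without local compactness). -/
theorem exists_nhds_image_smul_disjoint_of_finite (hfree : ∀ e : E, stabilizer D e = ⊥) (e : E) :
    ∃ U ∈ 𝓝 e, ∀ d : D, ((d • ·) '' U ∩ U).Nonempty → d = 1 := by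
  have hne : ∀ d : D, d ≠ 1 → d • e ≠ e := by
    intro d hd h
    have hmem : d ∈ stabilizer D e := mem_stabilizer_iff.mpr h
    rw [hfree e, Subgroup.mem_bot] at hmem
    exact hd hmem
  choose u v hu hv huv using fun s : {d : D // d ≠ 1} => t2_separation_nhds (hne s.1 s.2)
  refine ⟨⋂ s : {d : D // d ≠ 1}, (fun x => s.1 • x) ⁻¹' u s ∩ v s, ?_, fun d hd => ?_⟩
  · exact Filter.iInter_mem.mpr fun s =>
      Filter.inter_mem ((continuous_const_smul s.1).continuousAt.preimage_mem_nhds (hu s)) (hv s)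
  · by_contra h
    obtain ⟨_, ⟨z, hzU, rfl⟩, hdzU⟩ := hd
    have h1 : d • z ∈ u ⟨d, h⟩ := (Set.mem_iInter.mp hzU ⟨d, h⟩).1
    have h2 : d • z ∈ v ⟨d, h⟩ := (Set.mem_iInter.mp hdzU ⟨d, h⟩).2
    exact Set.disjoint_left.mp (huv ⟨d, h⟩) h1 h2

end FiniteFree

/-! ## §2  The stages map `X/Γ₁ → X/Γ` is a covering map -/

section Covering

variable {G X : Type*} [Group G] [MulAction G X] (Γ₁ Γ : Subgroup G)

/-- The fibres of `X/Γ₁ → X/Γ` are the orbits of the deck group `D = (deckHom Γ₁ Γ).range`. -/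
theorem orbitMap_eq_iff_mem_orbit (hle : Γ₁ ≤ Γ) [(Γ₁.subgroupOf Γ).Normal] (p q : orbitRel.Quotient Γ₁ X) :
    orbitMap Γ₁ Γ hle p = orbitMap Γ₁ Γ hle q ↔ p ∈ orbit (deckHom Γ₁ Γ hle (X := X)).range q := by
  rw [orbitMap_eq_iff, mem_orbit_iff]
  constructor
  · rintro ⟨γ, hγ⟩
    exact ⟨⟨deckHom Γ₁ Γ hle γ, γ, rfl⟩, hγ⟩
  · rintro ⟨⟨d, γ, rfl⟩, h⟩
    exact ⟨γ, h⟩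

variable [TopologicalSpace X] [ContinuousConstSMul G X]

/-- **Quotient covering.** `Γ₁ ⊴ Γ` of finite index, `Γ` acting freely, `X/Γ₁` Hausdorff: `X/Γ₁ → X/Γ` is a
quotient covering map for the (finite, free) deck group. -/
theorem isQuotientCoveringMap_orbitMap (hle : Γ₁ ≤ Γ) [(Γ₁.subgroupOf Γ).Normal] [(Γ₁.subgroupOf Γ).FiniteIndex]
    [T2Space (orbitRel.Quotient Γ₁ X)] (hfree : ∀ x : X, stabilizer G x ⊓ Γ = ⊥) :
    IsQuotientCoveringMap (orbitMap Γ₁ Γ hle (X := X)) (deckHom Γ₁ Γ hle (X := X)).range where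
  __ := isQuotientMap_orbitMap Γ₁ Γ hle
  apply_eq_iff_mem_orbit := orbitMap_eq_iff_mem_orbit Γ₁ Γ hle _ _
  disjoint := by
    haveI := finite_range_deckHom Γ₁ Γ hle (X := X)
    exact exists_nhds_image_smul_disjoint_of_finite (stabilizer_deck_eq_bot Γ₁ Γ hle hfree)

/-- **Finite étale, analytically: `X/Γ₁ → X/Γ` is a covering map.** -/
theorem isCoveringMap_orbitMap (hle : Γ₁ ≤ Γ) [(Γ₁.subgroupOf Γ).Normal] [(Γ₁.subgroupOf Γ).FiniteIndex]
    [T2Space (orbitRel.Quotient Γ₁ X)] (hfree : ∀ x : X, stabilizer G x ⊓ Γ = ⊥) :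
    IsCoveringMap (orbitMap Γ₁ Γ hle (X := X)) :=
  (isQuotientCoveringMap_orbitMap Γ₁ Γ hle hfree).isCoveringMap

/-- `X/Γ₁ → X/Γ` is moreover an OPEN quotient map. -/
theorem isOpenQuotientMap_orbitMap (hle : Γ₁ ≤ Γ) [(Γ₁.subgroupOf Γ).Normal] [(Γ₁.subgroupOf Γ).FiniteIndex]
    [T2Space (orbitRel.Quotient Γ₁ X)] (hfree : ∀ x : X, stabilizer G x ⊓ Γ = ⊥) :
    IsOpenQuotientMap (orbitMap Γ₁ Γ hle (X := X)) :=
  (isQuotientCoveringMap_orbitMap Γ₁ Γ hle hfree).isOpenQuotientMap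

/-- Every fibre of `X/Γ₁ → X/Γ` is a torsor under the deck group: a point of the fibre gives `fibre ≃ D`. -/
def fiberOrbitMapEquiv (hle : Γ₁ ≤ Γ) [(Γ₁.subgroupOf Γ).Normal] [(Γ₁.subgroupOf Γ).FiniteIndex]
    [T2Space (orbitRel.Quotient Γ₁ X)] (hfree : ∀ x : X, stabilizer G x ⊓ Γ = ⊥)
    {p : orbitRel.Quotient Γ X} (e : orbitMap Γ₁ Γ hle (X := X) ⁻¹' {p}) :
    orbitMap Γ₁ Γ hle (X := X) ⁻¹' {p} ≃ (deckHom Γ₁ Γ hle (X := X)).range :=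
  (isQuotientCoveringMap_orbitMap Γ₁ Γ hle hfree).fiberEquivGroup e

/-- **Degree.** Every fibre of `X/Γ₁ → X/Γ` has exactly `[Γ : Γ₁]` points. -/
theorem natCard_fiber_orbitMap (hle : Γ₁ ≤ Γ) [(Γ₁.subgroupOf Γ).Normal] [(Γ₁.subgroupOf Γ).FiniteIndex]
    [T2Space (orbitRel.Quotient Γ₁ X)] (hfree : ∀ x : X, stabilizer G x ⊓ Γ = ⊥)
    (p : orbitRel.Quotient Γ X) :
    Nat.card (orbitMap Γ₁ Γ hle (X := X) ⁻¹' {p}) = Γ₁.relIndex Γ := by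
  obtain ⟨q, hq⟩ := orbitMap_surjective Γ₁ Γ hle p
  obtain ⟨x, -⟩ := Quotient.exists_rep q
  rw [Nat.card_congr (fiberOrbitMapEquiv Γ₁ Γ hle hfree ⟨q, hq⟩)]
  exact natCard_range_deckHom_eq Γ₁ Γ hle (hfree x)

/-- The fibres are finite. -/
theorem finite_fiber_orbitMap (hle : Γ₁ ≤ Γ) [(Γ₁.subgroupOf Γ).Normal] [(Γ₁.subgroupOf Γ).FiniteIndex]
    [T2Space (orbitRel.Quotient Γ₁ X)] (hfree : ∀ x : X, stabilizer G x ⊓ Γ = ⊥)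
    (p : orbitRel.Quotient Γ X) :
    Finite (orbitMap Γ₁ Γ hle (X := X) ⁻¹' {p}) := by
  obtain ⟨q, hq⟩ := orbitMap_surjective Γ₁ Γ hle p
  haveI := finite_range_deckHom Γ₁ Γ hle (X := X)
  exact Finite.of_equiv _ (fiberOrbitMapEquiv Γ₁ Γ hle hfree ⟨q, hq⟩).symm

end Covering

end Stages

/-! ## §3  PerL: the pieces `Γ_H(gK₁g⁻¹)\\Y → Γ_H(gK_fg⁻¹)\\Y`, `Y = U(H)(ℝ)/C` -/

section PerLPieces

open HodgeCM.PerL34.Godement.Stages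
open HodgeCM.Adelic HodgeCM.PerL34.AdelicUnitaryFactorisation

/-- (Ported verbatim from the HodgeCMPerL package; no docstring in the source.) -/
private theorem isCompact_conj_smul₃ {B : Type*} [Group B] [TopologicalSpace B] [IsTopologicalGroup B]
    (K : Subgroup B) (hK : IsCompact (K : Set B)) (b : B) :
    IsCompact ((MulAut.conj b • K : Subgroup B) : Set B) := by
  have hset : ((MulAut.conj b • K : Subgroup B) : Set B) = (fun x => b * x * b⁻¹) '' (K : Set B) := by
    rw [Subgroup.coe_pointwise_smul, ← Set.image_smul]
    simp only [MulAut.smul_def, MulAut.conj_apply]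
  rw [hset]
  exact hK.image ((continuous_const.mul continuous_id).mul continuous_const)

variable (L : CMField) {m : ℕ} (H : Matrix (Fin m) (Fin m) L) (C : Subgroup (Uinf L H))
  (K₁ Kf : Subgroup (Ufin L H)) (g : Ufin L H)

/-- **Covering of pieces.** `C` compact, `Γ_H(gK₁g⁻¹) ⊴ Γ_H(gK_fg⁻¹)` of finite index, both discrete,
`Γ_H(gK_fg⁻¹)` torsion-free: `Γ_H(gK₁g⁻¹)\\Y → Γ_H(gK_fg⁻¹)\\Y` is a covering map (`Y = U(H)(ℝ)/C`). -/
theorem isCoveringMap_pieceOrbitMap (hC : IsCompact (C : Set (Uinf L H)))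
    [DiscreteTopology (congruenceLattice L H (MulAut.conj g • K₁))]
    [DiscreteTopology (congruenceLattice L H (MulAut.conj g • Kf))]
    (hle : congruenceLattice L H (MulAut.conj g • K₁) ≤ congruenceLattice L H (MulAut.conj g • Kf))
    (hN : ((congruenceLattice L H (MulAut.conj g • K₁)).subgroupOf
      (congruenceLattice L H (MulAut.conj g • Kf))).Normal)
    (hFI : ((congruenceLattice L H (MulAut.conj g • K₁)).subgroupOf
      (congruenceLattice L H (MulAut.conj g • Kf))).FiniteIndex)
    (htf : ∀ γ ∈ congruenceLattice L H (MulAut.conj g • Kf), IsOfFinOrder γ → γ = 1) :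
    IsCoveringMap (orbitMap (congruenceLattice L H (MulAut.conj g • K₁))
      (congruenceLattice L H (MulAut.conj g • Kf)) hle (X := Uinf L H ⧸ C)) := by
  have hT2 := HodgeCM.PerL34.ArchCompactK.t2Space_orbitQuotient_of_discrete C hC
    (congruenceLattice L H (MulAut.conj g • K₁))
  exact @isCoveringMap_orbitMap (Uinf L H) (Uinf L H ⧸ C) _ _ _ _ _ _ hle hN hFI hT2
    fun y => stabilizer_inf_eq_bot_of_torsionFree _ htf C hC y

/-- … and every fibre has exactly `[Γ_H(gK_fg⁻¹) : Γ_H(gK₁g⁻¹)]` points. -/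
theorem natCard_fiber_pieceOrbitMap (hC : IsCompact (C : Set (Uinf L H)))
    [DiscreteTopology (congruenceLattice L H (MulAut.conj g • K₁))]
    [DiscreteTopology (congruenceLattice L H (MulAut.conj g • Kf))]
    (hle : congruenceLattice L H (MulAut.conj g • K₁) ≤ congruenceLattice L H (MulAut.conj g • Kf))
    (hN : ((congruenceLattice L H (MulAut.conj g • K₁)).subgroupOf
      (congruenceLattice L H (MulAut.conj g • Kf))).Normal)
    (hFI : ((congruenceLattice L H (MulAut.conj g • K₁)).subgroupOf
      (congruenceLattice L H (MulAut.conj g • Kf))).FiniteIndex)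
    (htf : ∀ γ ∈ congruenceLattice L H (MulAut.conj g • Kf), IsOfFinOrder γ → γ = 1)
    (p : orbitRel.Quotient (congruenceLattice L H (MulAut.conj g • Kf)) (Uinf L H ⧸ C)) :
    Nat.card (orbitMap (congruenceLattice L H (MulAut.conj g • K₁))
      (congruenceLattice L H (MulAut.conj g • Kf)) hle (X := Uinf L H ⧸ C) ⁻¹' {p}) =
      (congruenceLattice L H (MulAut.conj g • K₁)).relIndex (congruenceLattice L H (MulAut.conj g • Kf)) := by
  have hT2 := HodgeCM.PerL34.ArchCompactK.t2Space_orbitQuotient_of_discrete C hC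
    (congruenceLattice L H (MulAut.conj g • K₁))
  exact @natCard_fiber_orbitMap (Uinf L H) (Uinf L H ⧸ C) _ _ _ _ _ _ hle hN hFI hT2
    (fun y => stabilizer_inf_eq_bot_of_torsionFree _ htf C hC y) p

/-- The covering record of one piece `g`: `Γ₁ = Γ_H(gK₁g⁻¹) ⊴ Γ = Γ_H(gK_fg⁻¹)` of finite index dividing
`[K_f : K₁]`, `Γ₁\\Y → Γ\\Y` a covering map all of whose fibres have `[Γ : Γ₁]` points (`Y = U(H)(ℝ)/C`). -/
structure PieceCovering : Prop where
  le : congruenceLattice L H (MulAut.conj g • K₁) ≤ congruenceLattice L H (MulAut.conj g • Kf)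
  normal : ((congruenceLattice L H (MulAut.conj g • K₁)).subgroupOf
    (congruenceLattice L H (MulAut.conj g • Kf))).Normal
  finiteIndex : ((congruenceLattice L H (MulAut.conj g • K₁)).subgroupOf
    (congruenceLattice L H (MulAut.conj g • Kf))).FiniteIndex
  relIndex_dvd : (congruenceLattice L H (MulAut.conj g • K₁)).relIndex
    (congruenceLattice L H (MulAut.conj g • Kf)) ∣ K₁.relIndex Kf
  isCoveringMap : IsCoveringMap (orbitMap (congruenceLattice L H (MulAut.conj g • K₁))
    (congruenceLattice L H (MulAut.conj g • Kf)) le (X := Uinf L H ⧸ C))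
  natCard_fiber : ∀ p : orbitRel.Quotient (congruenceLattice L H (MulAut.conj g • Kf)) (Uinf L H ⧸ C),
    Nat.card (orbitMap (congruenceLattice L H (MulAut.conj g • K₁))
      (congruenceLattice L H (MulAut.conj g • Kf)) le (X := Uinf L H ⧸ C) ⁻¹' {p}) =
      (congruenceLattice L H (MulAut.conj g • K₁)).relIndex (congruenceLattice L H (MulAut.conj g • Kf))

variable {L H C K₁ Kf g} in
/-- Assembling the record from the tower data of row #9 plus torsion-freeness of `Γ_H(gK_fg⁻¹)`. -/
theorem PieceCovering.of_tower (hC : IsCompact (C : Set (Uinf L H)))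
    [DiscreteTopology (congruenceLattice L H (MulAut.conj g • K₁))]
    [DiscreteTopology (congruenceLattice L H (MulAut.conj g • Kf))]
    (hle : congruenceLattice L H (MulAut.conj g • K₁) ≤ congruenceLattice L H (MulAut.conj g • Kf))
    (hN : ((congruenceLattice L H (MulAut.conj g • K₁)).subgroupOf
      (congruenceLattice L H (MulAut.conj g • Kf))).Normal)
    (hFI : ((congruenceLattice L H (MulAut.conj g • K₁)).subgroupOf
      (congruenceLattice L H (MulAut.conj g • Kf))).FiniteIndex)
    (hdvd : (congruenceLattice L H (MulAut.conj g • K₁)).relIndex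
      (congruenceLattice L H (MulAut.conj g • Kf)) ∣ K₁.relIndex Kf)
    (htf : ∀ γ ∈ congruenceLattice L H (MulAut.conj g • Kf), IsOfFinOrder γ → γ = 1) :
    PieceCovering L H C K₁ Kf g where
  le := hle
  normal := hN
  finiteIndex := hFI
  relIndex_dvd := hdvd
  isCoveringMap := isCoveringMap_pieceOrbitMap L H C K₁ Kf g hC hle hN hFI htf
  natCard_fiber := natCard_fiber_pieceOrbitMap L H C K₁ Kf g hC hle hN hFI htf

end PerLPieces

end HodgeCM.PerL34.Godement

/-! ## §4  `G_U`, level `K_f ≤ K_H(3)`: covering maps for every piece (PerL l. 75) -/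

namespace HodgeCM.HermSpace3

open HodgeCM.PerL34.Godement HodgeCM.PerL34.Godement.Stages
open HodgeCM.Adelic HodgeCM.PerL34.AdelicUnitaryFactorisation

variable (L : CMField) {ι₁ : L →+* ℂ} (V : HermSpace3 L ι₁)

/-- **PerL v5 l. 75, "P_{Γ₁} → P_Γ finite étale" at the level of `G_U(ℝ)/C`.**  For a hermitian 3-space
`V`, any compact `C ≤ G_U(ℝ)` and any compact open level `K_f ≤ K_H(3)` (so that every `Γ_H(gK_fg⁻¹)` is
torsion-free, row #8), there is an open compact `K₁ ≤ K_f`, normal of finite index, with `K₁ ≤ K_H(3)`, such that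
for EVERY `g` the map of pieces `Γ_H(gK₁g⁻¹)\\Y → Γ_H(gK_fg⁻¹)\\Y` (`Y = G_U(ℝ)/C`) is a COVERING MAP all of
whose fibres have exactly `[Γ_H(gK_fg⁻¹) : Γ_H(gK₁g⁻¹)]` points, a divisor of `[K_f : K₁]`. -/
theorem exists_pieces_isCoveringMap (C : Subgroup (Uinf L V.Hm)) (hC : IsCompact (C : Set (Uinf L V.Hm)))
    (Kf : Subgroup (Ufin L V.Hm)) (hKo : IsOpen (Kf : Set (Ufin L V.Hm)))
    (hKc : IsCompact (Kf : Set (Ufin L V.Hm))) (hK3 : Kf ≤ levelUfin L V.Hm 3) :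
    ∃ K₁ : Subgroup (Ufin L V.Hm), K₁ ≤ Kf ∧ K₁ ≤ levelUfin L V.Hm 3 ∧ IsOpen (K₁ : Set (Ufin L V.Hm)) ∧
      IsCompact (K₁ : Set (Ufin L V.Hm)) ∧ (K₁.subgroupOf Kf).Normal ∧ (K₁.subgroupOf Kf).FiniteIndex ∧
      ∀ g : Ufin L V.Hm, PieceCovering L V.Hm C K₁ Kf g := by
  obtain ⟨K₁, h1f, h13, hK1o, hK1c, hN, hFI, hg⟩ :=
    HodgeCM.PerL34.Godement.exists_torsionFree_normal_tower L V.Hm Kf hKo hKc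
  refine ⟨K₁, h1f, h13, hK1o, hK1c, hN, hFI, fun g => ?_⟩
  obtain ⟨hle, hNg, hFIg, hdvd, -⟩ := hg g
  haveI : DiscreteTopology (congruenceLattice L V.Hm (MulAut.conj g • K₁)) :=
    HodgeCM.HermSpace3.discreteTopology_congruenceLattice L V _ (isCompact_conj_smul₃ K₁ hK1c g)
  haveI : DiscreteTopology (congruenceLattice L V.Hm (MulAut.conj g • Kf)) :=
    HodgeCM.HermSpace3.discreteTopology_congruenceLattice L V _ (isCompact_conj_smul₃ Kf hKc g)
  exact PieceCovering.of_tower hC hle hNg hFIg hdvd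
    (HodgeCM.PerL34.Godement.torsionFree_congruenceLattice_conj L le_rfl hK3 g)

end HodgeCM.HermSpace3

end

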